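import Literature.NumberTheory.Automorphic.CDTTheorem722
import Literature.NumberTheory.Automorphic.CDTTheorem712
import Literature.NumberTheory.Automorphic.BCDTModularity
import Literature.NumberTheory.Automorphic.BCDTModularityModPProofs
import Literature.NumberTheory.Automorphic.HeckeAlgebraOfTypeSigma
import Literature.NumberTheory.EllipticCurves.FramedTateGaloisRep
import Literature.NumberTheory.EllipticCurves.FrobeniusTraceBaseChange
import Literature.NumberTheory.EllipticCurves.FrobeniusTateModuleProofs
import Literature.NumberTheory.EllipticCurves.TateModuleFreeProofs
import Literature.NumberTheory.EllipticCurves.TateModuleFinrankProofs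
import Literature.NumberTheory.EllipticCurves.NeronOggShafarevichProofs
import Literature.NumberTheory.EllipticCurves.IsogenyFrobeniusTraceProofs
import Literature.NumberTheory.EllipticCurves.ModularityVersionApProofs
import Literature.NumberTheory.GaloisRepresentations.FramedRepBaseChange
import Literature.NumberTheory.GaloisRepresentations.ResidualGaloisRep
import Literature.NumberTheory.GaloisRepresentations.IrreducibleOfIrreducibleReduction
import Literature.NumberTheory.GaloisRepresentations.OrdinaryGaloisRep
import Literature.NumberTheory.GaloisRepresentations.CalegariEvenFontaineMazurTwo
import Literature.NumberTheory.GaloisRepresentations.AbsolutelyIrreducibleReduction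
import Literature.NumberTheory.GaloisRepresentations.ResidualRepOfTraceCongruence
import Literature.NumberTheory.PAdicHodge.FontaineDpst
import Literature.NumberTheory.DiophantineGeometry.Conductor
import Literature.NumberTheory.DiophantineGeometry.LocalReduction
import Summits.ABC.ABC.Theorems.DefiniteXiFreyModularityStubNineTransfer
import HarnessLib

-- CRUX COMPANION COPY (stub critic scrit-stmt-ABC-11340-stub_liftThree, 2026-09-01): this is the PRE-BUILT
-- Theorems helper `Summits/ABC/ABC/Theorems/DefiniteXiFreyModularityLiftingSocket.lean` kept in a companion
-- namespace so that no `Summit.ABC.ABC.Theorems.*` name pre-exists in the tree.  TO LAND IT: change the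
-- `namespace` / `end` lines to `Summit.ABC.ABC.Theorems`, delete the `open Summit.ABC.ABC.Theorems` line and
-- this banner (STUB-PLAN-stub_liftThree.md §4.2); dry-run verdict in that form: ACCEPT (2026-09-01).

/-!
# Modularity lifting at a prime `ℓ` of semistable reduction, from the Diamond socket
# (helper for `stub_liftThree` / `stub_liftFive` of crux `FreyModularity`, stmt-ABC-11340, route DefiniteXi)

Stub `stub_liftThree` of `Summits/ABC/ABC/Cruxes/FreyModularity/Lines/Sketch.lean` (S1b, VERBATIM):

  `∀ (W : WeierstrassCurve ℚ) [W.IsElliptic] (ρ : ModPGaloisRep ℚ (ZMod 3) 2), W.IsTorsionGaloisRep 3 ρ →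
     ρ.IsAbsIrreducibleOverSqrt (-3) → ¬ 9 ∣ W.conductorNorm ℤ → ρ.IsModular → W.IsModularGaloisRepTate 3`

is the `ℓ = 3`, `9 ∤ N` instance of modularity lifting for elliptic curves semistable at `ℓ`
(Diamond 1996 Thm. 5.3; Conrad–Diamond–Taylor 1999 Thm. 7.2.1 restricted; in the tree the unproved
named fact `Literature.NumberTheory.Automorphic.BCDT.CDT_theorem_7_2_1`).  This file PROVES, for every
prime `ℓ`, the reduction of that instance to THREE curve-free / local inputs, each taken BY VALUE as a
hypothesis (no `Prop` currency is defined here — the inputs are spelled out):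

* the **Diamond socket** `hX` = Diamond, CSS XVII Cor. 6.2 (p. 571) = DDT Cor. 3.46 with "semistable"
  weakened to "semistable at `ℓ`" (cyclotomic determinant), its residual modularity hypothesis taken
  in the tree's any-weight currency `ModPGaloisRep.IsModular` (CSS XVII §5 reads "`ρ̄` modular" as
  weight 2, any level; any weight `≥ 1` → weight 2 for absolutely irreducible `ρ̄` is DDT Rem. 3.6 /
  Thm. 3.15, Ash–Stevens 1986 Thm. 3.5 — see the crux companion `STUB_PLAN_stub_liftThree_SocketAny.lean`,
  `liftingSocketAny_of_weightTwo`, for that adapter isolated as a separate hypothesis);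
* **ORD** `hO`: multiplicative reduction at `v ∣ ℓ` ⇒ `ρ_{W,ℓ}` ordinary of weight 2 at `v` (Tate curve;
  PROVED generically in the crux companion `STUB_IDEAS_stub_liftFive_3g10.lean`,
  `isOrdinaryOfWeightAt_framedTateGaloisRep_of_hasMultiplicativeReductionAt`, not yet landed);
* **CRYS** `hC`: good reduction at `v ∣ ℓ` ⇒ `ρ_{W,ℓ}|Γ_{ℚ_v}` crystalline with Hodge–Tate weights in
  `[-1, 0]` (Fontaine–Messing / Faltings).

Main results (PROVED): `isModularGaloisRepTate_of_liftingSocketAny` (any prime `ℓ`, any `d`) and its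
instances `liftThree_of_liftingSocketAny` (`ℓ = 3`, `d = -3`: conclusion = the stub VERBATIM),
`liftFive_of_liftingSocketAny` (`ℓ = 5`, `d = 5`: `stub_liftFive` verbatim); adapters RC / DET / UR / OUT /
LOCAL ported from the crux companions k1-liftFive-g6, k2-liftFive-g11, k1-liftThree-g13.  [cite: DiamondCSS1997,
Cor. 6.2 (p. 571)] [cite: Diamond1996, Thm. 5.3] [cite: DarmonDiamondTaylor1995, Cor. 3.46, Rem. 3.6, Thm. 3.15]
-/

set_option linter.dupNamespace false

noncomputable section

open scoped MatrixGroups Matrix NumberField ModularForm Polynomial Classical NNReal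
open NumberField IsDedekindDomain IsDedekindDomain.HeightOneSpectrum Polynomial Filter
open Literature.NumberTheory Literature.NumberTheory.Automorphic Literature.NumberTheory.Automorphic.BCDT
open Literature.NumberTheory.GaloisRepresentations Literature.NumberTheory.GaloisRepresentations.ModPGaloisRep
open Literature.NumberTheory.EllipticCurves Literature.NumberTheory.EllipticCurves.ModularForms
open Literature.NumberTheory.PAdicHodge
open CongruenceSubgroup Rat.HeightOneSpectrum WeierstrassCurve Field IsLocalRing

open Summit.ABC.ABC.Theorems

namespace Summit.ABC.ABC.Cruxes.FreyModularity.StubPlanLiftThreeHelper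

section Adapters

variable (ℓ : ℕ) [hℓ : Fact ℓ.Prime]

/-! ## §1 The curve-side adapters (PROVED): UR, UR-fin, charpoly, DET, RC, inertia, OUT, semistable split -/

/-- `p_v ≠ ℓ ⇒ ℓ ∉ v` for a finite place `v` of `ℚ`. [folklore] -/
theorem ell_not_mem_asIdeal_of_ne (v : HeightOneSpectrum (𝓞 ℚ))
    (hv : ((primesEquiv v : Nat.Primes) : ℕ) ≠ ℓ) : ((ℓ : ℕ) : 𝓞 ℚ) ∉ v.asIdeal := by
  intro h
  apply hv
  change natGenerator v = ℓ
  rw [← Nat.prime_dvd_prime_iff_eq (prime_natGenerator v) hℓ.out, natGenerator_dvd_iff,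
    ← map_natCast (Rat.IsIntegralClosure.intEquiv (𝓞 ℚ)) ℓ, Ideal.apply_mem_of_equiv_iff]
  exact h

/-- `ℓ ∈ v ⇒ p_v = ℓ`. [folklore] -/
theorem primesEquiv_eq_of_mem (v : HeightOneSpectrum (𝓞 ℚ))
    (hv : ((ℓ : ℕ) : 𝓞 ℚ) ∈ v.asIdeal) : ((primesEquiv v : Nat.Primes) : ℕ) = ℓ :=
  Classical.by_contradiction fun h => ell_not_mem_asIdeal_of_ne ℓ v h hv

/-- **UR**: `p_v ∤ N_W`, `p_v ≠ ℓ` ⇒ `ρ_{W,ℓ}` unramified at `v` (Néron–Ogg–Shafarevich). [cite: SilvermanAEC2009, Prop. VII.4.1(b)] -/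
theorem isUnramifiedAt_framedTateGaloisRep_of_not_dvd_conductorNorm (W : WeierstrassCurve ℚ) [W.IsElliptic]
    (v : HeightOneSpectrum (𝓞 ℚ)) (hN : ¬ ((primesEquiv v : Nat.Primes) : ℕ) ∣ W.conductorNorm ℤ)
    (hv : ((primesEquiv v : Nat.Primes) : ℕ) ≠ ℓ) : (W.framedTateGaloisRep ℓ).IsUnramifiedAt v := by
  have hgood : W.HasGoodReductionAt v := by
    by_contra h
    exact hN ((W.dvd_conductorNorm_iff v).mpr h)
  exact W.isUnramifiedAt_framedTateGaloisRep ℓ hgood (ell_not_mem_asIdeal_of_ne ℓ v hv)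

/-- **UR-fin**: `ρ_{W,ℓ}` is unramified outside the FINITE set `{q : q ∣ N_W} ∪ {ℓ}`. [folklore] -/
theorem exists_finite_isUnramifiedAt_framedTateGaloisRep (W : WeierstrassCurve ℚ) [W.IsElliptic] :
    ∃ S : Set ℕ, S.Finite ∧ ∀ v : HeightOneSpectrum (𝓞 ℚ),
      ((primesEquiv v : Nat.Primes) : ℕ) ∉ S → (W.framedTateGaloisRep ℓ).IsUnramifiedAt v := by
  refine ⟨{q | q ∣ W.conductorNorm ℤ} ∪ {ℓ}, ?_, fun v hv => ?_⟩
  · refine Set.Finite.union ?_ (Set.finite_singleton ℓ)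
    exact (Nat.divisors (W.conductorNorm ℤ)).finite_toSet.subset fun q hq =>
      by simpa [Nat.mem_divisors, (conductorNorm_pos_holds W).ne'] using hq
  · simp only [Set.mem_union, Set.mem_setOf_eq, Set.mem_singleton_iff, not_or] at hv
    exact isUnramifiedAt_framedTateGaloisRep_of_not_dvd_conductorNorm ℓ W v hv.1 hv.2

/-- The characteristic polynomial of the framed `ρ_{E,ℓ}(σ)` is `charpoly(σ | T_ℓ E)` over `ℚ̄_ℓ`. [folklore] -/
theorem charpoly_framedTateGaloisRep_eq_map_map (W : WeierstrassCurve ℚ) [W.IsElliptic]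
    (σ : absoluteGaloisGroup ℚ) :
    haveI := module_free_tateModule_holds W ℓ
    haveI := module_finite_tateModule_holds W ℓ
    FramedRep.charpoly (W.framedTateGaloisRep ℓ) σ =
      ((W.galoisRepTate ℓ σ).charpoly.map (PadicInt.Coe.ringHom (p := ℓ))).map
        (algebraMap ℚ_[ℓ] (PadicAlgCl ℓ)) := by
  haveI := module_free_tateModule_holds W ℓ
  haveI := module_finite_tateModule_holds W ℓ
  rw [W.charpoly_framedTateGaloisRep_apply ℓ σ]
  congr 1
  have hc : (algebraMap ℤ_[ℓ] ℚ_[ℓ] : ℤ_[ℓ] →+* ℚ_[ℓ]) = PadicInt.Coe.ringHom := RingHom.ext fun _ => rfl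
  rw [← hc]
  exact LinearMap.charpoly_baseChange (W.galoisRepTate ℓ σ) ℚ_[ℓ]

/-- **DET**: `det ρ_{W,ℓ}(σ) = χ_ℓ(σ)` in `ℚ̄_ℓ`. [cite: SilvermanAEC2009, III.8.3] -/
theorem det_framedTateGaloisRep_eq_cyclotomic (W : WeierstrassCurve ℚ) [W.IsElliptic]
    (σ : absoluteGaloisGroup ℚ) :
    ((W.framedTateGaloisRep ℓ σ : GL (Fin 2) (PadicAlgCl ℓ)) : Matrix (Fin 2) (Fin 2) (PadicAlgCl ℓ)).det =
      algebraMap ℚ_[ℓ] (PadicAlgCl ℓ) (PadicInt.Coe.ringHom (p := ℓ)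
        ((GaloisRep.cyclotomicCharacter ℚ ℓ σ : ℤ_[ℓ]ˣ) : ℤ_[ℓ])) := by
  have hℓ0 : ((ℓ : ℕ) : ℚ) ≠ 0 := Nat.cast_ne_zero.mpr hℓ.out.ne_zero
  haveI := module_free_tateModule_holds W ℓ
  haveI := module_finite_tateModule_holds W ℓ
  rw [Matrix.det_eq_sign_charpoly_coeff]
  have hc : ((W.framedTateGaloisRep ℓ σ : GL (Fin 2) (PadicAlgCl ℓ)) :
      Matrix (Fin 2) (Fin 2) (PadicAlgCl ℓ)).charpoly = FramedRep.charpoly (W.framedTateGaloisRep ℓ) σ := rfl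
  rw [hc, charpoly_framedTateGaloisRep_eq_map_map ℓ W σ, Polynomial.coeff_map, Polynomial.coeff_map,
    Fintype.card_fin]
  have hdet := LinearMap.det_eq_sign_charpoly_coeff (W.galoisRepTate ℓ σ)
  rw [finrank_tateModule_eq_two_holds W ℓ hℓ0] at hdet
  rw [← W.det_galoisRepTate_eq_cyclotomicCharacter_holds ℓ hℓ0 σ, hdet]
  norm_num

/-- **RC**: `ρ̄ ≅ W[ℓ]` gives the residual characteristic polynomials of `ρ_{W,ℓ}` relative to `ρ̄ ⊗ 𝔽̄_ℓ`
(`ρ̄` pushed along `𝔽_ℓ → ℤ̄_ℓ/𝔪`, `zmodToPadicAlgClResidueField`): `P_σ := charpoly(σ | T_ℓ W) ∈ ℤ_ℓ[X]`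
pushed to `ℤ̄_ℓ[X]` along the ring map `ℤ_ℓ → ℤ̄_ℓ`, which reduces to `x ↦ x mod ℓ`.
[cite: DarmonDiamondTaylor1995, §2.1] -/
theorem hasResidualCharpolys_framedTateGaloisRep_of_isTorsionGaloisRep (W : WeierstrassCurve ℚ) [W.IsElliptic]
    (ρ : ModPGaloisRep ℚ (ZMod ℓ) 2) (hρ : W.IsTorsionGaloisRep ℓ ρ) :
    HasResidualCharpolys (RingHom.id (padicAlgClResidueField ℓ))
      (W.framedTateGaloisRep ℓ : absoluteGaloisGroup ℚ →* GL (Fin 2) (PadicAlgCl ℓ))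
      ((Matrix.GeneralLinearGroup.map (zmodToPadicAlgClResidueField ℓ)).comp
        (ρ : absoluteGaloisGroup ℚ →* GL (Fin 2) (ZMod ℓ))) := by
  -- the ring map `φ : ℤ_ℓ → ℤ̄_ℓ` over `ℚ_ℓ → ℚ̄_ℓ`, packaged with its defining property
  obtain ⟨φ, hφ⟩ : ∃ φ : ℤ_[ℓ] →+* padicAlgClIntegers ℓ, ∀ x : ℤ_[ℓ],
      ((φ x : padicAlgClIntegers ℓ) : PadicAlgCl ℓ) = algebraMap ℚ_[ℓ] (PadicAlgCl ℓ) (x : ℚ_[ℓ]) :=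
    ⟨((algebraMap ℚ_[ℓ] (PadicAlgCl ℓ)).comp (PadicInt.Coe.ringHom (p := ℓ))).codRestrict
        (padicAlgClIntegers ℓ) fun x => by
          rw [padicAlgCl_mem_valuationSubring_iff]
          change ‖((x : ℚ_[ℓ]) : PadicAlgCl ℓ)‖ ≤ 1
          rw [PadicAlgCl.norm_extends, ← PadicInt.norm_def]
          exact PadicInt.norm_le_one x,
      fun _ => rfl⟩
  -- B1a: `φ` reduces to `x ↦ x mod ℓ`
  have hres : ∀ x : ℤ_[ℓ], residue (padicAlgClIntegers ℓ) (φ x) =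
      ((PadicInt.toZMod (p := ℓ) x).val : padicAlgClResidueField ℓ) := by
    intro x
    rw [← map_natCast (residue (padicAlgClIntegers ℓ)) (PadicInt.toZMod (p := ℓ) x).val]
    apply residue_eq_of_norm_sub_lt_one
    have hmem := PadicInt.toZMod_spec x
    rw [IsLocalRing.mem_maximalIdeal, PadicInt.mem_nonunits, ZMod.cast_eq_val] at hmem
    rw [← map_natCast φ (PadicInt.toZMod (p := ℓ) x).val, ← AddSubgroupClass.coe_sub, ← map_sub, hφ]
    change ‖(((x - ((PadicInt.toZMod (p := ℓ) x).val : ℤ_[ℓ]) : ℤ_[ℓ]) : ℚ_[ℓ]) : PadicAlgCl ℓ)‖ < 1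
    rw [PadicAlgCl.norm_extends, ← PadicInt.norm_def]
    exact hmem
  intro σ
  haveI := module_free_tateModule_holds W ℓ
  haveI := module_finite_tateModule_holds W ℓ
  have hℓ0 : ((ℓ : ℕ) : ℚ) ≠ 0 := Nat.cast_ne_zero.mpr hℓ.out.ne_zero
  have hf : (padicAlgClIntegers ℓ).subtype.comp φ =
      (algebraMap ℚ_[ℓ] (PadicAlgCl ℓ)).comp (PadicInt.Coe.ringHom (p := ℓ)) := RingHom.ext fun x => hφ x
  refine ⟨((W.galoisRepTate ℓ σ).charpoly).map φ, ?_, ?_⟩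
  · rw [Polynomial.map_map, hf, ← Polynomial.map_map]
    exact (charpoly_framedTateGaloisRep_eq_map_map ℓ W σ).symm
  · have hR : ((((Matrix.GeneralLinearGroup.map (zmodToPadicAlgClResidueField ℓ)).comp
          (ρ : absoluteGaloisGroup ℚ →* GL (Fin 2) (ZMod ℓ))) σ : GL (Fin 2) (padicAlgClResidueField ℓ)) :
        Matrix (Fin 2) (Fin 2) (padicAlgClResidueField ℓ)).charpoly =
        (((ρ σ : GL (Fin 2) (ZMod ℓ)) : Matrix (Fin 2) (Fin 2) (ZMod ℓ)).charpoly).map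
          (zmodToPadicAlgClResidueField ℓ) := by
      rw [← Matrix.charpoly_map]
      rfl
    rw [Polynomial.map_map, hR, hρ.charpoly_eq_map_charpoly_galoisRepTate W ℓ hℓ0 σ, Polynomial.map_map]
    congr 1
    refine RingHom.ext fun x => ?_
    rw [RingHom.comp_apply, RingHom.comp_apply, RingHom.id_apply, hres x, RingHom.comp_apply]
    conv_rhs => rw [← ZMod.natCast_zmod_val (PadicInt.toZMod (p := ℓ) x)]
    rw [map_natCast]

/-- Framed `ρ_{E,ℓ}` unramified at `v` ⇒ inertia at `v` acts trivially on `T_ℓ E`. [folklore] -/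
theorem galoisRepTate_eq_one_of_isUnramifiedAt_framedTateGaloisRep (W : WeierstrassCurve ℚ) [W.IsElliptic]
    {v : HeightOneSpectrum (𝓞 ℚ)} (h : (W.framedTateGaloisRep ℓ).IsUnramifiedAt v) :
    ∀ 𝔓 ∈ v.primesAbove, ∀ σ ∈ 𝔓.inertia (absoluteGaloisGroup ℚ), W.galoisRepTate ℓ σ = 1 := by
  intro 𝔓 h𝔓 σ hσ
  have h1 := ((W.isUnramifiedAt_framedTateGaloisRep_iff ℓ
    (W.continuous_rationalGaloisRepTate_holds ℓ) v).mp h) 𝔓 h𝔓 σ hσ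
  exact W.galoisRepTate_eq_one_of_rationalGaloisRepTate_eq_one ℓ h1

/-- **OUT**: "`ρ_{W,ℓ}` is modular" in DDT's sense (Def. 3.16: `ρ_{W,ℓ} ≅ ρ_{g,ι}` for a weight-2
newform `g`, framed, `IsGaloisRepOfNewform1`) ⇒ BCDT's condition (4) `IsModularGaloisRepTate`.
[cite: DarmonDiamondTaylor1995, Def. 3.16 (p. 91)] -/
theorem isModularGaloisRepTate_of_isGaloisRepOfNewform1 (W : WeierstrassCurve ℚ) [W.IsElliptic]
    {M : ℕ} [NeZero M] (g : CuspForm (Gamma1 M) 2) (ι : coeffCharField g →+* PadicAlgCl ℓ)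
    (hg : IsNewform1 g) (hatt : IsGaloisRepOfNewform1 g ι {r | r ∣ M * ℓ} (W.framedTateGaloisRep ℓ)) :
    W.IsModularGaloisRepTate ℓ := by
  haveI := module_free_tateModule_holds W ℓ
  haveI := module_finite_tateModule_holds W ℓ
  refine ⟨M, inferInstance, 2, g, PadicAlgCl ℓ, inferInstance, inferInstance, ι, by norm_num, hg, ?_⟩
  intro v hv 𝔓 h𝔓
  obtain ⟨hur, hchar⟩ := hatt v hv
  refine ⟨galoisRepTate_eq_one_of_isUnramifiedAt_framedTateGaloisRep ℓ W hur 𝔓 h𝔓, fun σ hσ => ?_⟩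
  have hc := hchar 𝔓 h𝔓 σ hσ
  rw [charpoly_framedTateGaloisRep_eq_map_map ℓ W σ] at hc
  rw [← Polynomial.map_map, ← W.map_charpoly_galoisRepTate_eq ℓ (PadicInt.Coe.ringHom (p := ℓ)) σ]
  exact hc

/-- **SEMISTABLE SPLIT at `v ∣ ℓ`**: `ℓ² ∤ N_W` ⇒ good or multiplicative reduction at the place over `ℓ`
(landed `sq_dvd_conductorNorm_iff_hasAdditiveReductionAt` + trichotomy). [cite: SilvermanATAEC1994, Thm. IV.10.2(a)] -/
theorem hasGoodReductionAt_or_hasMultiplicativeReductionAt_of_not_sq_dvd_conductorNorm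
    (W : WeierstrassCurve ℚ) [W.IsElliptic] (hN : ¬ ℓ ^ 2 ∣ W.conductorNorm ℤ)
    (v : HeightOneSpectrum (𝓞 ℚ)) (hv : ((ℓ : ℕ) : 𝓞 ℚ) ∈ v.asIdeal) :
    W.HasGoodReductionAt v ∨ W.HasMultiplicativeReductionAt v := by
  have hadd : ¬ W.HasAdditiveReductionAt v := fun h =>
    hN ((sq_dvd_conductorNorm_iff_hasAdditiveReductionAt W hℓ.out (primesEquiv_eq_of_mem ℓ v hv)).mpr h)
  exact (isSemistableAt_iff_not_hasAdditiveReductionAt v W).mpr hadd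

/-- **LOCAL**: `ℓ² ∤ N_W` + ORD + CRYS ⇒ `ρ_{W,ℓ}` semistable at every `v ∣ ℓ` in the sense of DDT §2.4
(ordinary of weight 2, or crystalline with Hodge–Tate weights in `[-1,0]`). [cite: DarmonDiamondTaylor1995, §2.4] -/
theorem isOrdinary_or_isCrystalline_framedTateGaloisRep_of_not_sq_dvd_conductorNorm
    (hO : ∀ (W : WeierstrassCurve ℚ) [W.IsElliptic] (v : HeightOneSpectrum (𝓞 ℚ)),
      ((ℓ : ℕ) : 𝓞 ℚ) ∈ v.asIdeal → W.HasMultiplicativeReductionAt v →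
      FramedGaloisRep.IsOrdinaryOfWeightAt ℓ (W.framedTateGaloisRep ℓ) v 2 1)
    (hC : ∀ (W : WeierstrassCurve ℚ) [W.IsElliptic] (v : HeightOneSpectrum (𝓞 ℚ))
      (hv : ((ℓ : ℕ) : 𝓞 ℚ) ∈ v.asIdeal), W.HasGoodReductionAt v →
      (fontainePstAdicCompletion v ℓ hv).IsCrystallineFramed ((W.framedTateGaloisRep ℓ).toLocal v) ∧
        (fontainePstAdicCompletion v ℓ hv).IsDeRhamWithWeightsIn (-1) 0
          ((W.framedTateGaloisRep ℓ).toLocal v))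
    (W : WeierstrassCurve ℚ) [W.IsElliptic] (hN : ¬ ℓ ^ 2 ∣ W.conductorNorm ℤ)
    (v : HeightOneSpectrum (𝓞 ℚ)) (hv : ((ℓ : ℕ) : 𝓞 ℚ) ∈ v.asIdeal) :
    FramedGaloisRep.IsOrdinaryOfWeightAt ℓ (W.framedTateGaloisRep ℓ) v 2 1 ∨
      ((fontainePstAdicCompletion v ℓ hv).IsCrystallineFramed ((W.framedTateGaloisRep ℓ).toLocal v) ∧
        (fontainePstAdicCompletion v ℓ hv).IsDeRhamWithWeightsIn (-1) 0
          ((W.framedTateGaloisRep ℓ).toLocal v)) := by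
  rcases hasGoodReductionAt_or_hasMultiplicativeReductionAt_of_not_sq_dvd_conductorNorm ℓ W hN v hv
    with hg | hm
  · exact Or.inr (hC W v hv hg)
  · exact Or.inl (hO W v hv hm)

end Adapters

/-! ## §2 THE GLUE (PROVED): Diamond socket + ORD + CRYS ⇒ modularity lifting at `ℓ` for `ℓ² ∤ N` -/

/-- **Modularity lifting for elliptic curves semistable at `ℓ`, from the Diamond socket.**  For any
prime `ℓ` and any `d : ℚ`: IF (socket `hX`, Diamond CSS XVII Cor. 6.2 / DDT Cor. 3.46 with the
residual input in the any-weight currency) every continuous `τ : Γ_ℚ → GL₂(ℚ̄_ℓ)` lifting a modular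
`ρ̄` with `ρ̄|Γ_{ℚ(√d)}` absolutely irreducible, with `det τ = χ_ℓ`, unramified almost everywhere and
semistable at `ℓ`, comes from a weight-2 newform, and IF (`hO`, `hC`) multiplicative (resp. good)
reduction at `v ∣ ℓ` makes `ρ_{W,ℓ}` ordinary of weight 2 (resp. crystalline `[-1,0]`) at `v`, THEN for
every elliptic `W/ℚ` with `ℓ² ∤ N_W` whose `W[ℓ] ≅ ρ̄` is modular and absolutely irreducible on
`Γ_{ℚ(√d)}`, `ρ_{W,ℓ}` is modular (`IsModularGaloisRepTate`).  Instantiate the socket at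
`τ := ρ_{W,ℓ}`: RC, DET, UR-fin, LOCAL above; exit through OUT.
[cite: DiamondCSS1997, Cor. 6.2 (p. 571)] [cite: DarmonDiamondTaylor1995, Cor. 3.46 (p. 102)] -/
theorem isModularGaloisRepTate_of_liftingSocketAny (ℓ : ℕ) [Fact ℓ.Prime] (d : ℚ)
    (hX : ∀ (ρ : ModPGaloisRep ℚ (ZMod ℓ) 2) (τ : FramedGaloisRep ℚ (PadicAlgCl ℓ) 2),
      ρ.IsModular → ρ.IsAbsIrreducibleOverSqrt d →
      HasResidualCharpolys (RingHom.id (padicAlgClResidueField ℓ))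
        (τ : absoluteGaloisGroup ℚ →* GL (Fin 2) (PadicAlgCl ℓ))
        ((Matrix.GeneralLinearGroup.map (zmodToPadicAlgClResidueField ℓ)).comp
          (ρ : absoluteGaloisGroup ℚ →* GL (Fin 2) (ZMod ℓ))) →
      (∀ σ : absoluteGaloisGroup ℚ,
        ((τ σ : GL (Fin 2) (PadicAlgCl ℓ)) : Matrix (Fin 2) (Fin 2) (PadicAlgCl ℓ)).det =
          algebraMap ℚ_[ℓ] (PadicAlgCl ℓ) (PadicInt.Coe.ringHom (p := ℓ)
            ((GaloisRep.cyclotomicCharacter ℚ ℓ σ : ℤ_[ℓ]ˣ) : ℤ_[ℓ]))) →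
      (∃ S : Set ℕ, S.Finite ∧ ∀ v : HeightOneSpectrum (𝓞 ℚ),
        ((primesEquiv v : Nat.Primes) : ℕ) ∉ S → τ.IsUnramifiedAt v) →
      (∀ (v : HeightOneSpectrum (𝓞 ℚ)) (hv : ((ℓ : ℕ) : 𝓞 ℚ) ∈ v.asIdeal),
        FramedGaloisRep.IsOrdinaryOfWeightAt ℓ τ v 2 1 ∨
          ((fontainePstAdicCompletion v ℓ hv).IsCrystallineFramed (τ.toLocal v) ∧
            (fontainePstAdicCompletion v ℓ hv).IsDeRhamWithWeightsIn (-1) 0 (τ.toLocal v))) →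
      ∃ (M : ℕ) (_ : NeZero M) (g : CuspForm (Gamma1 M) 2) (ι : coeffCharField g →+* PadicAlgCl ℓ),
        IsNewform1 g ∧ IsGaloisRepOfNewform1 g ι {r | r ∣ M * ℓ} τ)
    (hO : ∀ (W : WeierstrassCurve ℚ) [W.IsElliptic] (v : HeightOneSpectrum (𝓞 ℚ)),
      ((ℓ : ℕ) : 𝓞 ℚ) ∈ v.asIdeal → W.HasMultiplicativeReductionAt v →
      FramedGaloisRep.IsOrdinaryOfWeightAt ℓ (W.framedTateGaloisRep ℓ) v 2 1)
    (hC : ∀ (W : WeierstrassCurve ℚ) [W.IsElliptic] (v : HeightOneSpectrum (𝓞 ℚ))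
      (hv : ((ℓ : ℕ) : 𝓞 ℚ) ∈ v.asIdeal), W.HasGoodReductionAt v →
      (fontainePstAdicCompletion v ℓ hv).IsCrystallineFramed ((W.framedTateGaloisRep ℓ).toLocal v) ∧
        (fontainePstAdicCompletion v ℓ hv).IsDeRhamWithWeightsIn (-1) 0
          ((W.framedTateGaloisRep ℓ).toLocal v))
    (W : WeierstrassCurve ℚ) [W.IsElliptic] (ρ : ModPGaloisRep ℚ (ZMod ℓ) 2)
    (hρ : W.IsTorsionGaloisRep ℓ ρ) (hirr : ρ.IsAbsIrreducibleOverSqrt d)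
    (hN : ¬ ℓ ^ 2 ∣ W.conductorNorm ℤ) (hmod : ρ.IsModular) : W.IsModularGaloisRepTate ℓ := by
  obtain ⟨M, hM, g, ι, hg, hatt⟩ := hX ρ (W.framedTateGaloisRep ℓ) hmod hirr
    (hasResidualCharpolys_framedTateGaloisRep_of_isTorsionGaloisRep ℓ W ρ hρ)
    (det_framedTateGaloisRep_eq_cyclotomic ℓ W) (exists_finite_isUnramifiedAt_framedTateGaloisRep ℓ W)
    (fun v hv => isOrdinary_or_isCrystalline_framedTateGaloisRep_of_not_sq_dvd_conductorNorm ℓ hO hC W hN v hv)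
  exact isModularGaloisRepTate_of_isGaloisRepOfNewform1 ℓ W g ι hg hatt

/-! ## §3 The two registered stubs, VERBATIM, from three inputs each -/

/-- **`stub_liftThree` (S1b) ⟸ Diamond socket at `ℓ = 3`, `d = -3` + ORD₃ + CRYS₃.**  Conclusion =
the registered stub of `Cruxes/FreyModularity/Lines/Sketch.lean` VERBATIM (uncurried, instance binder
in place).  [cite: Diamond1996, Thm. 5.3] [cite: ConradDiamondTaylor1999, Thm. 7.2.1]
[cite: DiamondCSS1997, Cor. 6.2 (p. 571)] -/
theorem liftThree_of_liftingSocketAny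
    (hX : ∀ (ρ : ModPGaloisRep ℚ (ZMod 3) 2) (τ : FramedGaloisRep ℚ (PadicAlgCl 3) 2),
      ρ.IsModular → ρ.IsAbsIrreducibleOverSqrt (-3) →
      HasResidualCharpolys (RingHom.id (padicAlgClResidueField 3))
        (τ : absoluteGaloisGroup ℚ →* GL (Fin 2) (PadicAlgCl 3))
        ((Matrix.GeneralLinearGroup.map (zmodToPadicAlgClResidueField 3)).comp
          (ρ : absoluteGaloisGroup ℚ →* GL (Fin 2) (ZMod 3))) →
      (∀ σ : absoluteGaloisGroup ℚ,
        ((τ σ : GL (Fin 2) (PadicAlgCl 3)) : Matrix (Fin 2) (Fin 2) (PadicAlgCl 3)).det =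
          algebraMap ℚ_[3] (PadicAlgCl 3) (PadicInt.Coe.ringHom (p := 3)
            ((GaloisRep.cyclotomicCharacter ℚ 3 σ : ℤ_[3]ˣ) : ℤ_[3]))) →
      (∃ S : Set ℕ, S.Finite ∧ ∀ v : HeightOneSpectrum (𝓞 ℚ),
        ((primesEquiv v : Nat.Primes) : ℕ) ∉ S → τ.IsUnramifiedAt v) →
      (∀ (v : HeightOneSpectrum (𝓞 ℚ)) (hv : ((3 : ℕ) : 𝓞 ℚ) ∈ v.asIdeal),
        FramedGaloisRep.IsOrdinaryOfWeightAt 3 τ v 2 1 ∨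
          ((fontainePstAdicCompletion v 3 hv).IsCrystallineFramed (τ.toLocal v) ∧
            (fontainePstAdicCompletion v 3 hv).IsDeRhamWithWeightsIn (-1) 0 (τ.toLocal v))) →
      ∃ (M : ℕ) (_ : NeZero M) (g : CuspForm (Gamma1 M) 2) (ι : coeffCharField g →+* PadicAlgCl 3),
        IsNewform1 g ∧ IsGaloisRepOfNewform1 g ι {r | r ∣ M * 3} τ)
    (hO : ∀ (W : WeierstrassCurve ℚ) [W.IsElliptic] (v : HeightOneSpectrum (𝓞 ℚ)),
      ((3 : ℕ) : 𝓞 ℚ) ∈ v.asIdeal → W.HasMultiplicativeReductionAt v →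
      FramedGaloisRep.IsOrdinaryOfWeightAt 3 (W.framedTateGaloisRep 3) v 2 1)
    (hC : ∀ (W : WeierstrassCurve ℚ) [W.IsElliptic] (v : HeightOneSpectrum (𝓞 ℚ))
      (hv : ((3 : ℕ) : 𝓞 ℚ) ∈ v.asIdeal), W.HasGoodReductionAt v →
      (fontainePstAdicCompletion v 3 hv).IsCrystallineFramed ((W.framedTateGaloisRep 3).toLocal v) ∧
        (fontainePstAdicCompletion v 3 hv).IsDeRhamWithWeightsIn (-1) 0
          ((W.framedTateGaloisRep 3).toLocal v)) :
    ∀ (W : WeierstrassCurve ℚ) [W.IsElliptic] (ρ : ModPGaloisRep ℚ (ZMod 3) 2),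
      W.IsTorsionGaloisRep 3 ρ → ρ.IsAbsIrreducibleOverSqrt (-3) → ¬ 9 ∣ W.conductorNorm ℤ →
      ρ.IsModular → W.IsModularGaloisRepTate 3 := by
  intro W _ ρ hρ hirr hN hmod
  have h9 : ¬ 3 ^ 2 ∣ W.conductorNorm ℤ := by norm_num; exact hN
  exact isModularGaloisRepTate_of_liftingSocketAny 3 (-3) hX hO hC W ρ hρ hirr h9 hmod

/-- **`stub_liftFive` (S2) ⟸ THE SAME socket at `ℓ = 5`, `d = 5` + ORD₅ + CRYS₅** — one glue serves
S1b and S2.  Conclusion = the registered `stub_liftFive` VERBATIM. [cite: Diamond1996, Thm. 5.3]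
[cite: ConradDiamondTaylor1999, Thm. 7.2.2] -/
theorem liftFive_of_liftingSocketAny
    (hX : ∀ (ρ : ModPGaloisRep ℚ (ZMod 5) 2) (τ : FramedGaloisRep ℚ (PadicAlgCl 5) 2),
      ρ.IsModular → ρ.IsAbsIrreducibleOverSqrt 5 →
      HasResidualCharpolys (RingHom.id (padicAlgClResidueField 5))
        (τ : absoluteGaloisGroup ℚ →* GL (Fin 2) (PadicAlgCl 5))
        ((Matrix.GeneralLinearGroup.map (zmodToPadicAlgClResidueField 5)).comp
          (ρ : absoluteGaloisGroup ℚ →* GL (Fin 2) (ZMod 5))) →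
      (∀ σ : absoluteGaloisGroup ℚ,
        ((τ σ : GL (Fin 2) (PadicAlgCl 5)) : Matrix (Fin 2) (Fin 2) (PadicAlgCl 5)).det =
          algebraMap ℚ_[5] (PadicAlgCl 5) (PadicInt.Coe.ringHom (p := 5)
            ((GaloisRep.cyclotomicCharacter ℚ 5 σ : ℤ_[5]ˣ) : ℤ_[5]))) →
      (∃ S : Set ℕ, S.Finite ∧ ∀ v : HeightOneSpectrum (𝓞 ℚ),
        ((primesEquiv v : Nat.Primes) : ℕ) ∉ S → τ.IsUnramifiedAt v) →
      (∀ (v : HeightOneSpectrum (𝓞 ℚ)) (hv : ((5 : ℕ) : 𝓞 ℚ) ∈ v.asIdeal),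
        FramedGaloisRep.IsOrdinaryOfWeightAt 5 τ v 2 1 ∨
          ((fontainePstAdicCompletion v 5 hv).IsCrystallineFramed (τ.toLocal v) ∧
            (fontainePstAdicCompletion v 5 hv).IsDeRhamWithWeightsIn (-1) 0 (τ.toLocal v))) →
      ∃ (M : ℕ) (_ : NeZero M) (g : CuspForm (Gamma1 M) 2) (ι : coeffCharField g →+* PadicAlgCl 5),
        IsNewform1 g ∧ IsGaloisRepOfNewform1 g ι {r | r ∣ M * 5} τ)
    (hO : ∀ (W : WeierstrassCurve ℚ) [W.IsElliptic] (v : HeightOneSpectrum (𝓞 ℚ)),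
      ((5 : ℕ) : 𝓞 ℚ) ∈ v.asIdeal → W.HasMultiplicativeReductionAt v →
      FramedGaloisRep.IsOrdinaryOfWeightAt 5 (W.framedTateGaloisRep 5) v 2 1)
    (hC : ∀ (W : WeierstrassCurve ℚ) [W.IsElliptic] (v : HeightOneSpectrum (𝓞 ℚ))
      (hv : ((5 : ℕ) : 𝓞 ℚ) ∈ v.asIdeal), W.HasGoodReductionAt v →
      (fontainePstAdicCompletion v 5 hv).IsCrystallineFramed ((W.framedTateGaloisRep 5).toLocal v) ∧
        (fontainePstAdicCompletion v 5 hv).IsDeRhamWithWeightsIn (-1) 0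
          ((W.framedTateGaloisRep 5).toLocal v)) :
    ∀ (W : WeierstrassCurve ℚ) [W.IsElliptic] (ρ : ModPGaloisRep ℚ (ZMod 5) 2),
      W.IsTorsionGaloisRep 5 ρ → ρ.IsAbsIrreducibleOverSqrt 5 → ¬ 25 ∣ W.conductorNorm ℤ →
      ρ.IsModular → W.IsModularGaloisRepTate 5 := by
  intro W _ ρ hρ hirr hN hmod
  have h25 : ¬ 5 ^ 2 ∣ W.conductorNorm ℤ := by norm_num; exact hN
  exact isModularGaloisRepTate_of_liftingSocketAny 5 5 hX hO hC W ρ hρ hirr h25 hmod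

end Summit.ABC.ABC.Cruxes.FreyModularity.StubPlanLiftThreeHelper
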